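import Literature.IUT.HodgeTheaters.TemperedCoveringsCor23viHatIncidenceStrongNV
import HarnessLib

/-!
# [IUTchI] Cor. 2.3 (vi): the STRONG non-vacuity datum for `hF`, packaged

S. Mochizuki, *Inter-universal Teichmüller theory I: construction of Hodge theaters*, kurims manuscript (May
2020), §2, Cor. 2.3 (vi) p. 48 [cite: Mochizuki2012, Cor 2.3(vi) p.48] (D-0012 claim key; nothing of the series
is asserted here); S. Mochizuki, *Semi-graphs of anabelioids*, Publ. RIMS **42** (2006), Thm. 3.7 (i)/(iii)
pp. 40–41 [cite: MochizukiSemiAnbd2006, Thm 3.7 p.40].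

PROOF-ONLY sequel (abc-iut cell, seat abc-iut-L5-d5 gen 9, L5 ROWS #7 row R58 «COR23VI-HF-STRONG-NV»; cone row
`IUTchI:Cor2.3(vi)`, count-neutral) of `TemperedCoveringsCor23viHatIncidenceStrongNV.lean`: the `∃`-PACKAGED
datum in the style of abc-iut-w4-d059's `PiData.exists_hatEdgeIncidence_cuspEdgeDict_jointly` — a semi-graph of
anabelioids `𝒢` with [SemiAnbd] Thm. 3.7's hypotheses, two DISTINCT vertices `v₀ ≠ v₁`, an OPEN edge `e₁` abutting
`v₁ ∉ ℍ := {v₀}` only (so the conclusion of `hF` FAILS at `e₁`), and for EVERY chart, EVERY `h36`, EVERY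
`Π^tp_ℍ ∈ decompSubgroups c ℍ` (NONEMPTY, as is `edgeLikeSubgroups c e₁`, [SemiAnbd] Thm. 3.7 (i)/(iii)): the
non-conjugacy (a) and `hF` VERBATIM (b) of `hatEdgeIncidence_strong_restrict`.  Carrier: abc-iut-L3's
`thetaRayFreeProP p n` restricted to `{v₀, v₁; e₀, e₁}`.  No definition, no instance, no new `Prop` fact;
consistency evidence for OUR binder only; `hF` is NOT thereby proved at any genuine special fibre.  Nothing here
bears on [IUTchIII] Cor. 3.12; typed ≠ inhabited ≠ discharged; nothing asserts abc proved or refuted.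
-/

noncomputable section

namespace Literature.IUT.HodgeTheaters

open CategoryTheory _root_.Topology
open scoped Pointwise
open Literature.AnabelianGeometry.SemiGraphs
open Literature.AnabelianGeometry.SemiGraphs.ProfiniteSemiGraph

namespace StrongHatEdgeIncidenceNV

open FreeProPRankTwo Multiplicative

/-- **STRONG NON-VACUITY of the pro-`Σ̂` edge–subgraph incidence `hF` (L5 ROWS #7, R58).**  There are a
semi-graph of anabelioids `𝒢` satisfying [SemiAnbd] Thm. 3.7's hypotheses WITH TWO DISTINCT VERTICES `v₀ ≠ v₁`,
an OPEN edge `e₁` (one branch abutting to `v₁`, the other to nothing) and the sub-semi-graph `ℍ = {v₀}` — so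
that NO branch of `e₁` abuts to a vertex of `ℍ`, i.e. `hF`'s conclusion FAILS at `e₁` — such that for EVERY
chart `c`, EVERY `h36` and EVERY `Π^tp_ℍ ∈ decompSubgroups c ℍ` (a NONEMPTY family, as is `edgeLikeSubgroups c e₁`):
`ι(L) ⊄ g · closure ι(Π^tp_ℍ) · g⁻¹` for all edge-like `L` at `e₁` and all `g ∈ Π̂_𝔾`, and `hF` holds at
`(c, ι, Π^tp_ℍ, ℍ)` VERBATIM in the shape of abc-iut-w4-d059's `PiData.exists_hatEdgeIncidence_cuspEdgeDict_jointly`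
(there: one vertex, `hF` «for the one-vertex reason»; here: finite-quotient separation in the completion).
Carrier: abc-iut-L3's `thetaRayFreeProP p n` restricted to its first two vertices.  Consistency evidence for OUR
binder only. [cite: Mochizuki2012, Cor 2.3(vi) p.48] [claim: Mochizuki2012, status: disputed] -/
theorem exists_hatEdgeIncidence_strong (p : ℕ) [Fact p.Prime] (n : ℕ → ℕ) :
    ∃ (𝒢 : ProfiniteSemiGraph.{0}) (_ : 𝒢.Thm37Hypotheses) (H : 𝒢.graph.Subgraph) (v₀ v₁ : 𝒢.graph.Vertex)
      (e₁ : 𝒢.graph.Edge),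
      v₀ ≠ v₁ ∧ H.verts = {v₀} ∧ H.edges = ∅ ∧
      (∃ b : 𝒢.graph.Branch, 𝒢.graph.edgeOf b = e₁ ∧ 𝒢.graph.abuts b = some v₁) ∧
      (∃ b : 𝒢.graph.Branch, 𝒢.graph.edgeOf b = e₁ ∧ 𝒢.graph.abuts b = none) ∧
      (∀ b : 𝒢.graph.Branch, 𝒢.graph.edgeOf b = e₁ → ∀ w ∈ H.verts, 𝒢.graph.abuts b ≠ some w) ∧
      ∀ (c : TemperedPiChart 𝒢) (h36 : 𝒢.Prop36Hypotheses),
        (c.decompSubgroups H).Nonempty ∧ (edgeLikeSubgroups c e₁).Nonempty ∧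
        ∀ TpH ∈ c.decompSubgroups H,
          (∀ L ∈ edgeLikeSubgroups c e₁,
            ∀ g : (TemperedGraphGroupData.exists_completion_of_prop36 𝒢 h36 c).choose,
              ¬ L.map (TemperedGraphGroupData.exists_completion_of_prop36 𝒢 h36 c).choose_spec.choose.toMonoidHom ≤
                MulAut.conj g • (TpH.map (TemperedGraphGroupData.exists_completion_of_prop36 𝒢 h36
                  c).choose_spec.choose.toMonoidHom).topologicalClosure) ∧
          (∀ (e : 𝒢.graph.Edge), ∀ L ∈ edgeLikeSubgroups c e,
            ∀ g : (TemperedGraphGroupData.exists_completion_of_prop36 𝒢 h36 c).choose,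
              L.map (TemperedGraphGroupData.exists_completion_of_prop36 𝒢 h36 c).choose_spec.choose.toMonoidHom ≤
                MulAut.conj g • (TpH.map (TemperedGraphGroupData.exists_completion_of_prop36 𝒢 h36
                  c).choose_spec.choose.toMonoidHom).topologicalClosure →
              ∃ b : 𝒢.graph.Branch, 𝒢.graph.edgeOf b = e ∧ ∃ w ∈ H.verts, 𝒢.graph.abuts b = some w) := by
  have h0 : (0 : ℕ) ∈ Set.Iic (1 : ℕ) := Set.mem_Iic.mpr (Nat.zero_le 1)
  have h1 : (1 : ℕ) ∈ Set.Iic (1 : ℕ) := Set.mem_Iic.mpr le_rfl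
  let v₀ : (⟨Set.Iic (1 : ℕ), Set.Iic (1 : ℕ)⟩ : SemiGraph.ray.Subgraph).toSemiGraph.Vertex := ⟨0, h0⟩
  let v₁ : (⟨Set.Iic (1 : ℕ), Set.Iic (1 : ℕ)⟩ : SemiGraph.ray.Subgraph).toSemiGraph.Vertex := ⟨1, h1⟩
  let e₁ : (⟨Set.Iic (1 : ℕ), Set.Iic (1 : ℕ)⟩ : SemiGraph.ray.Subgraph).toSemiGraph.Edge := ⟨1, h1⟩
  refine ⟨(thetaRayFreeProP p n).restrict (⟨Set.Iic (1 : ℕ), Set.Iic (1 : ℕ)⟩ : SemiGraph.ray.Subgraph),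
    thm37Hypotheses_restrict p n, ⟨{v₀}, ∅⟩, v₀, v₁, e₁, fun h => Nat.zero_ne_one (congrArg Subtype.val h), rfl, rfl,
    ⟨⟨(1, false), h1⟩, rfl, (restrictRay_abuts_iff _ _).mpr rfl⟩, ⟨⟨(1, true), h1⟩, rfl, restrictRay_abuts_one_true h1⟩, ?_, ?_⟩
  · rintro ⟨⟨k, c⟩, hk⟩ hb w hw habs
    have hk' : k = 1 := congrArg Subtype.val hb
    subst hk'
    have hw' : w = v₀ := hw
    subst hw'
    have := (restrictRay_abuts_iff _ _).mp habs
    cases c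
    · simp only [Bool.false_eq_true, ite_false] at this
      exact Nat.one_ne_zero this
    · simp only [ite_true] at this
      exact Nat.succ_ne_zero 1 this
  · intro c h36
    refine ⟨TemperedPiChart.decompSubgroups_singleVertex_nonempty h36.isQuasiCoherent h36.isGaloisCountable c v₀,
      edgeLikeSubgroups_nonempty_of c ⟨(1, false), h1⟩ v₁ ((restrictRay_abuts_iff _ _).mpr rfl)
        (exists_isVerticialHom h36.isQuasiCoherent h36.isGaloisCountable c v₁),
      fun TpH hTpH => hatEdgeIncidence_strong_restrict p n v₀ rfl e₁ rfl c h36 TpH hTpH⟩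


end StrongHatEdgeIncidenceNV

end Literature.IUT.HodgeTheaters

end
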